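import Summits.BirchSwinnertonDyer.Rank1Residual.WAll.TargetAdditiveAtThreeWildLocalTypeTresRamifie
import Literature.NumberTheory.EllipticCurves.OrdinaryReductionTorsionLineProofs
import Literature.NumberTheory.EllipticCurves.IsogenyFrobeniusTraceProofs
import Literature.NumberTheory.EllipticCurves.LFunctionPrimeCoeff
import HarnessLib
import HarnessLib.Audit.Tags

/-!
# Rung W-ALL, row 2 at `p = 3`, the wild rank-one TWIN cell read through Serre's local type, II:
# a class with NO `D_3`-stable line in `E[3]` (census bucket C, «irreducible at 3») has no GOOD
# ORDINARY twin (theorems only; no new statement)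

Cell `bsd-wall` (run/shared/lean/pub/bsd-wall/), lane (2), seat `bsd-wall-ty-1` (g9); companion of
`TargetAdditiveAtThreeWildLocalTypeTresRamifie.lean` (bucket B: très ramifié ⇒ no good twin, every
semistable twin multiplicative). BOOKKEEPING in the vocabulary of `O6.ModPCongruentAt` /
`O6.ModPCongruent` (additive isomorphisms of geometric `p`-torsion, equivariant for the decomposition
group `GreenbergSelmer.decomp v` / for `Γ_ℚ`): nothing asserted, no leaf typed, no named fact, no def.

MATHEMATICS (Serre 1972, §1.11 Prop. 11 and Cor.: at a place of good ORDINARY reduction the kernel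
`X_p` of reduction is a LINE of `E[p]` stable under the decomposition group — tree theorem
`Literature.NumberTheory.EllipticCurves.exists_line_geomTorsion_of_not_dvd_frobeniusTraceAt`,
`OrdinaryReductionTorsionLineProofs.lean`): a `D_v`-stable subgroup of order `p` of `E′[p]` is carried
to a `D_v`-stable subgroup of order `p` of `E[p]` by any `D_v`-equivariant additive isomorphism
`E′[p] ≃ E[p]` (`ModPCongruentAt.exists_decompStableLine_of_decompStableLine`). Hence:
* `ModPCongruentAt.exists_decompStableLine_of_goodOrd` — a curve congruent AT `v ∋ p` to a curve with
  good ORDINARY reduction at `p` (`Rank1Residual.GoodOrd`) has a `D_v`-stable line in its `E[p]`;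
* `ModPCongruentAt.not_goodOrd_of_forall_not_decompStable` — contrapositive: if NO subgroup of order
  `p` of `E[p]` is `D_v`-stable («`ρ̄_{E,p}|D_v` irreducible», spelled inline, def-free), then no curve
  congruent to `E` at `v` is good ordinary at `p`; `ModPCongruent.…` for global twins;
* at `p = 3` on the twin-cell hypothesis of `WAllExclAddWildRankOneSurjTwin` VERBATIM:
  `twin_not_goodOrd_three_of_forall_not_decompStable` — every semistable twin of a bucket-C class is
  multiplicative or good SUPERSINGULAR at `3` (`twin_mult_or_goodSS_three_…`), i.e. route
  `UniversalToricDescent`'s crux #3 is never consumed in its good-ordinary instance there (census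
  TWIN-PRINT-AT3-v1 §2 bucket C, 603 classes: «NB for ST-irr classes a 3-coprime twin is supersingular,
  not ordinary» — now class-wide at every conductor for the ORDINARY exclusion; the MULTIPLICATIVE
  exclusion for bucket C needs the `D_v`-stability of the Tate line at `v ∣ p`, which the tree states
  only on inertia (`MultiplicativeReductionPeuRamifieProofs`), and is NOT claimed here).

References: `WAll/TargetAdditiveAtThreeWildLocalTypeTresRamifie.lean`, `WAll/TargetAdditiveAtThreeWildLocalTypeSlices.lean`
§0, `WAll/TargetAdditiveAtThreeWildTwinSlices.lean`; HOME `TWIN-PRINT-AT3-v1.md` §2;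
[cite: SerreInventiones1972, §1.11 Prop. 11 and Cor.]; [cite: Serre1987, §2.8 (2.8.2)].
-/

noncomputable section

open scoped Classical NumberField

open IsDedekindDomain Rat.HeightOneSpectrum
open WeierstrassCurve Literature.NumberTheory.EllipticCurves
  Literature.NumberTheory.EllipticCurves.Rank1Residual
  Literature.NumberTheory.GaloisRepresentations
open Summit.BirchSwinnertonDyer.Rank1Residual

set_option autoImplicit false

/-! ### §1. Vocabulary level, any prime `p` -/

namespace Summit.BirchSwinnertonDyer.Rank1Residual.O6

variable {W W' : WeierstrassCurve ℚ} {p : ℕ} {v : HeightOneSpectrum (𝓞 ℚ)}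

/-- **Transport of a `D_v`-stable line along a congruence at `v`.** If `W′[p] ≅ W[p]` as `D_v`-modules
(`ModPCongruentAt W′ W p v`) and `W′[p]` has a subgroup of order `p` stable under `D_v`, then so has
`W[p]` (its image). [folklore] -/
theorem ModPCongruentAt.exists_decompStableLine_of_decompStableLine (hc : ModPCongruentAt W' W p v)
    (h : ∃ Λ' : AddSubgroup (geomPoints W'), Λ' ≤ W'.geomTorsion (p : ℤ) ∧ Nat.card Λ' = p ∧
      ∀ σ ∈ GreenbergSelmer.decomp (K := ℚ) v, ∀ x ∈ Λ', σ • x ∈ Λ') :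
    ∃ Λ : AddSubgroup (geomPoints W), Λ ≤ W.geomTorsion (p : ℤ) ∧ Nat.card Λ = p ∧
      ∀ σ ∈ GreenbergSelmer.decomp (K := ℚ) v, ∀ x ∈ Λ, σ • x ∈ Λ := by
  obtain ⟨e, he⟩ := hc
  obtain ⟨Λ', hle, hcard, hstab⟩ := h
  -- the image of `Λ'` under `e`, pushed back into `geomPoints W`
  let f : ↥(W'.geomTorsion (p : ℤ)) →+ geomPoints W :=
    (W.geomTorsion (p : ℤ)).subtype.comp e.toAddMonoidHom
  have hf : Function.Injective f :=
    (W.geomTorsion (p : ℤ)).subtype_injective.comp e.injective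
  refine ⟨(Λ'.addSubgroupOf (W'.geomTorsion (p : ℤ))).map f, ?_, ?_, ?_⟩
  · -- inside `W[p]`
    rintro x ⟨y, -, rfl⟩
    exact (e y).2
  · -- order `p`
    rw [AddSubgroup.card_map_of_injective hf,
      Nat.card_congr (AddSubgroup.addSubgroupOfEquivOfLe hle).toEquiv, hcard]
  · -- `D_v`-stability
    rintro σ hσ x ⟨y, hy, rfl⟩
    have hy' : ((y : geomPoints W') : geomPoints W') ∈ Λ' := AddSubgroup.mem_addSubgroupOf.mp hy
    have hσy : ((σ • y : ↥(W'.geomTorsion (p : ℤ))) : geomPoints W') ∈ Λ' := by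
      rw [AddSubgroup.torsionBy.coe_smul]
      exact hstab σ hσ _ hy'
    refine ⟨σ • y, AddSubgroup.mem_addSubgroupOf.mpr hσy, ?_⟩
    change ((e (σ • y) : ↥(W.geomTorsion (p : ℤ))) : geomPoints W) =
      σ • ((e y : ↥(W.geomTorsion (p : ℤ))) : geomPoints W)
    rw [he σ hσ y, AddSubgroup.torsionBy.coe_smul]

variable [Fact p.Prime] [W'.IsElliptic]

/-- **A curve congruent at `v ∋ p` to a GOOD ORDINARY curve has a `D_v`-stable line in `E[p]`**
(Serre 1972 §1.11 Prop. 11 / Cor.: the kernel of reduction `X_p ≤ E′[p]` is a `Γ_{ℚ_v}`-stable line —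
tree `exists_line_geomTorsion_of_not_dvd_frobeniusTraceAt` —, transported along the congruence).
[cite: SerreInventiones1972, §1.11 Prop. 11 and Cor.] -/
theorem ModPCongruentAt.exists_decompStableLine_of_goodOrd [W'.IsGloballyMinimal]
    (hc : ModPCongruentAt W' W p v) (hpv : ((p : ℕ) : 𝓞 ℚ) ∈ v.asIdeal) (hord : GoodOrd W' p) :
    ∃ Λ : AddSubgroup (geomPoints W), Λ ≤ W.geomTorsion (p : ℤ) ∧ Nat.card Λ = p ∧
      ∀ σ ∈ GreenbergSelmer.decomp (K := ℚ) v, ∀ x ∈ Λ, σ • x ∈ Λ := by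
  -- `v` is THE place above `p`
  have hpe : (primesEquiv (R := 𝓞 ℚ) v : ℕ) = p :=
    (Literature.NumberTheory.Automorphic.BCDT.natCast_mem_asIdeal_iff_primesEquiv_eq v Fact.out).mp
      hpv
  have hgoodv : W'.HasGoodReductionAt v :=
    (hasGoodReductionAtPrime_primesEquiv_iff_holds W' v p hpe).mp hord.1
  have hordv : ¬ ((p : ℤ) ∣ W'.frobeniusTraceAt v) := by
    rw [frobeniusTraceAt_eq_frobeniusTrace, hpe]; exact hord.2
  obtain ⟨Λ', hle, hcard, hstab, -⟩ :=
    exists_line_geomTorsion_of_not_dvd_frobeniusTraceAt W' p v hpv hgoodv hordv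
  refine hc.exists_decompStableLine_of_decompStableLine ⟨Λ', hle, hcard, ?_⟩
  rintro σ ⟨τ, rfl⟩ x hx
  exact hstab τ x hx

/-- **No good-ordinary congruent curve for a locally irreducible `E[p]`.** If no subgroup of order `p`
of `E[p]` is stable under `D_v` («`ρ̄_{E,p}|D_v` irreducible»; spelled inline), then no curve congruent
to `E` at `v ∋ p` has good ordinary reduction at `p`.
[cite: SerreInventiones1972, §1.11 Prop. 11 and Cor.] -/
theorem ModPCongruentAt.not_goodOrd_of_forall_not_decompStable [W'.IsGloballyMinimal]
    (hc : ModPCongruentAt W' W p v) (hpv : ((p : ℕ) : 𝓞 ℚ) ∈ v.asIdeal)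
    (hirr : ∀ Λ : AddSubgroup (geomPoints W), Λ ≤ W.geomTorsion (p : ℤ) → Nat.card Λ = p →
      ∃ σ ∈ GreenbergSelmer.decomp (K := ℚ) v, ∃ x ∈ Λ, σ • x ∉ Λ) :
    ¬ GoodOrd W' p := by
  intro hord
  obtain ⟨Λ, hle, hcard, hstab⟩ := hc.exists_decompStableLine_of_goodOrd hpv hord
  obtain ⟨σ, hσ, x, hx, hσx⟩ := hirr Λ hle hcard
  exact hσx (hstab σ hσ x hx)

/-- **Global twins of a locally irreducible class are not good ordinary at `p`.**
[cite: SerreInventiones1972, §1.11 Prop. 11 and Cor.] -/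
theorem ModPCongruent.not_goodOrd_of_forall_not_decompStable [W'.IsGloballyMinimal]
    (hc : ModPCongruent W' W p)
    (hirr : ∀ (v : HeightOneSpectrum (𝓞 ℚ)), ((p : ℕ) : 𝓞 ℚ) ∈ v.asIdeal →
      ∀ Λ : AddSubgroup (geomPoints W), Λ ≤ W.geomTorsion (p : ℤ) → Nat.card Λ = p →
        ∃ σ ∈ GreenbergSelmer.decomp (K := ℚ) v, ∃ x ∈ Λ, σ • x ∉ Λ) :
    ¬ GoodOrd W' p := by
  obtain ⟨v, hpv⟩ : ∃ v : HeightOneSpectrum (𝓞 ℚ), ((p : ℕ) : 𝓞 ℚ) ∈ v.asIdeal :=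
    ⟨(primesEquiv (R := 𝓞 ℚ)).symm ⟨p, Fact.out⟩,
      (Literature.NumberTheory.Automorphic.BCDT.natCast_mem_asIdeal_iff_primesEquiv_eq _ Fact.out).mpr
        (by rw [Equiv.apply_symm_apply])⟩
  exact (hc.modPCongruentAt v).not_goodOrd_of_forall_not_decompStable hpv (hirr v hpv)

/-- **Semistable twins of a locally irreducible class are multiplicative or good SUPERSINGULAR at `p`**
(`¬ Addv` is `Good ∨ Mult`; `Good ∧ ¬GoodOrd` is `GoodSS`). [cite: SerreInventiones1972, §1.11] -/
theorem ModPCongruent.mult_or_goodSS_of_forall_not_decompStable_of_not_addv [W'.IsGloballyMinimal]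
    (hc : ModPCongruent W' W p)
    (hirr : ∀ (v : HeightOneSpectrum (𝓞 ℚ)), ((p : ℕ) : 𝓞 ℚ) ∈ v.asIdeal →
      ∀ Λ : AddSubgroup (geomPoints W), Λ ≤ W.geomTorsion (p : ℤ) → Nat.card Λ = p →
        ∃ σ ∈ GreenbergSelmer.decomp (K := ℚ) v, ∃ x ∈ Λ, σ • x ∉ Λ)
    (hss : ¬ Addv W' p) : Mult W' p ∨ GoodSS W' p := by
  have hno : ¬ GoodOrd W' p := hc.not_goodOrd_of_forall_not_decompStable hirr
  by_cases hm : Mult W' p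
  · exact Or.inl hm
  · have hg : Good W' p := by
      by_contra hg
      exact hss ⟨hg, hm⟩
    refine Or.inr ⟨hg, ?_⟩
    by_contra hdvd
    exact hno ⟨hg, hdvd⟩

end Summit.BirchSwinnertonDyer.Rank1Residual.O6

/-! ### §2. Leaf level at `p = 3`: the twin cell's twins of a locally irreducible class -/

namespace Summit.BirchSwinnertonDyer

/-- **On the twin-cell hypothesis of `WAllExclAddWildRankOneSurjTwin` (VERBATIM): a semistable onto
twin `W′` of a class with NO `D_3`-stable line in `E[3]` is NOT good ordinary at `3`** — census bucket C
(«irreducible at 3»): route `UniversalToricDescent`'s crux #3 is never consumed in its good-ordinary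
instance there. [cite: SerreInventiones1972, §1.11 Prop. 11 and Cor.] -/
theorem twin_not_goodOrd_three_of_forall_not_decompStable {W : WeierstrassCurve ℚ}
    (hirr : ∀ (v : HeightOneSpectrum (𝓞 ℚ)), ((3 : ℕ) : 𝓞 ℚ) ∈ v.asIdeal →
      ∀ Λ : AddSubgroup (geomPoints W), Λ ≤ W.geomTorsion ((3 : ℕ) : ℤ) → Nat.card Λ = 3 →
        ∃ σ ∈ GreenbergSelmer.decomp (K := ℚ) v, ∃ x ∈ Λ, σ • x ∉ Λ)
    (W' : WeierstrassCurve ℚ) [W'.IsElliptic] [W'.IsGloballyMinimal]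
    (hc : O6.ModPCongruent W' W 3) : ¬ GoodOrd W' 3 :=
  hc.not_goodOrd_of_forall_not_decompStable hirr

/-- **… hence it is multiplicative or good supersingular at `3`.** [cite: SerreInventiones1972, §1.11] -/
theorem twin_mult_or_goodSS_three_of_forall_not_decompStable {W : WeierstrassCurve ℚ}
    (hirr : ∀ (v : HeightOneSpectrum (𝓞 ℚ)), ((3 : ℕ) : 𝓞 ℚ) ∈ v.asIdeal →
      ∀ Λ : AddSubgroup (geomPoints W), Λ ≤ W.geomTorsion ((3 : ℕ) : ℤ) → Nat.card Λ = 3 →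
        ∃ σ ∈ GreenbergSelmer.decomp (K := ℚ) v, ∃ x ∈ Λ, σ • x ∉ Λ)
    (W' : WeierstrassCurve ℚ) [W'.IsElliptic] [W'.IsGloballyMinimal]
    (hc : O6.ModPCongruent W' W 3) (hss : ¬ Addv W' 3) : Mult W' 3 ∨ GoodSS W' 3 :=
  hc.mult_or_goodSS_of_forall_not_decompStable_of_not_addv hirr hss

end Summit.BirchSwinnertonDyer
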